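import Summits.QuantumFields.BalabanUV.Beta.D1BFx.GramWeightDeterminant
import Summits.QuantumFields.BalabanUV.Beta.D1BFx.SliceTransferModel

/-!
# `BalabanUV.Beta.D1BFx.GramWeightSecondVariation` — road «BF-x» for binder row D1, slot (K), X₃(ii) ROUTE T, brick **K-TA4G «GRAM FORM OF
# THE JET IDENTITY»** (`HOME/b2b-balaban-beta-d1-p2/K-ASSEMBLY-SPEC-v2.md` v2.1 §2, shape (R2) «canonical co-frame», owner ruling ρ-g6-5),
# PART 2a — THE CURVE LEVEL: along a `C²` background curve, `secondVar M + secondVar Φ = secondVar N + 2·secondVar G` for the comb-gauged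
# bordered system `M = kkt K [Q; τ]`, the WEIGHTED bordered system `N = kkt (K + B) Q`, the Faddeev–Popov GRAM `Φ = WᵀBW` and the comb Gram
# `G = τW`, under a co-frame factorisation `B = τ′ᵀAτ′` of the weight; and the GRAM SPLIT `secondVar Φ = 2·secondVar (τ′W) + secondVar A`

HONEST DEPENDENCY (cell records, verbatim): «continuum YM on T⁴ ⇐ BetaPertH ∧ nine spine estimates (0/9 proved); BetaPertH ⇐ (D1) ∧ (D4) ∧
CAP+tail; G-an2-4 gates asym, D1 and NE2/3/4.»  HONEST FRAMING (cell contract, verbatim): «discharging `BetaPertH` makes Bałaban's UV stability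
UNCONDITIONAL — a real constructive-QFT result; it is NOT the continuum limit and NOT the Clay problem.»  THIS MODULE DISCHARGES NOTHING of (K),
of D1 or of the wall: [folklore] finite-dimensional calculus over PART 1 `GramWeightDeterminant` (`log_absDet_gramTransfer_coframe`,
`det_gram_coframe`), the road owner's model chain `LogDetSecondVariation` (`secondVar`, `secondVar_comb_eq_zero`) ∕ `SliceTransferModel` (the
matrix-curve `HasDerivAt` suppliers) and `Literature.Analysis.Calculus.eventually_det_ne_zero`, all BY NAME.  No definition, no `def … : Prop`,
nothing cited, no wall binder instantiated, 0 sorry.  NOT D1, NOT BetaPertH, NOT continuum, NOT Clay.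

ABSOLUTE RULE (cell charter, verbatim): «No internally-minted statement may enter as a cited fact. Every hypothesis is either kernel-proved in this
package or a verbatim quotation of a PUBLISHED theorem with page reference. The manuscript(s) under audit are NOT citable for their own disputed
steps — they are the thing under adjudication; programme-internal (2001/route/tribunal) claims are never citable.»

WHY (K-ASSEMBLY-SPEC v2.1 «v2.1 AMENDMENTS», K-TA4G of record).  The road's N-side weight `B = 2·dRδ` has rank `|ρ|` and the canonical,
frame-free co-frame factorisation `B(U) = τ′(U)ᵀA(U)τ′(U)`, `τ′ := NᵀΔ_Uδ_U`, `A := 2(NᵀΔ_U²N)⁻¹` (owner ρ-g6-5); the slice-transfer identity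
then holds in GRAM currency.  This is `SliceTransferModel.secondVar_sliceTransfer` with the square Faddeev–Popov matrix `F = PW` replaced by the
Gram `Φ = WᵀBW` (`2·secondVar F ↦ secondVar Φ`), proved the same way: the four composite curves and their jets (product rule), the logarithmic
identity `log|det N| + 2·log|det G| = log|det Φ| + log|det M|` near `0` (PART 1), differentiated twice (`secondVar_comb_eq_zero`).
CONTENT:
* [folklore] **`secondVar_gramTransfer`**: curves `K, Q, B, W` of class `C²` at `0` (first-jet curves, second jets), constant `τ`; near `0` the
  Ward relations `KW = 0`, `KᵀW = 0`, `QW = 0`, a factorisation `B = τ′ᵀAτ′` with `det(τ′W) ≠ 0`, `det A ≠ 0` (NO derivative of `τ′`, `A` is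
  used); at `0`: `det(τW) ≠ 0`, `det M ≠ 0` ⟹ `secondVar M + secondVar Φ = secondVar N + 2·secondVar G` (jets as the product rule delivers
  them; `N`'s jets are `kkt (K₁ + B₁) Q₁`, `kkt (K₂ + B₂) Q₂`).
* [folklore] **`secondVar_gram_split`**: with `τ′`, `A` also `C²`: `secondVar Φ = 2·secondVar (τ′W) + secondVar A`.
NOT HERE (PART 2b, next): jets from bare jet data via the dressed curves of `SliceTransferJets` (Ward relations) and polynomial curves for
`τ′`, `A`, `W`; polarisation to `mixedVar`; the `hessT` read-out (TA4 pattern) — the v2.0-printed conclusion.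
Provenance: G-an2-4 formalisation swarm leaf seat `b2b-balaban-gan24-formalise-leaf-03` gen 44 (cross-lane), claim «K-TA4G» PART 2a, 2026-08-20.
-/

namespace Summit.QuantumFields.BalabanUV.Beta.D1BFx.GramWeightSecondVariation

open Matrix Filter Topology
open Literature.MathematicalPhysics.QuantumFieldTheory.Balaban1983to89.Beta.Composition (kkt)
open Literature.Analysis.Calculus (eventually_det_ne_zero)
open Summit.QuantumFields.BalabanUV.Beta.D1BFx.LogDetSecondVariation (secondVar secondVar_comb_eq_zero)
open Summit.QuantumFields.BalabanUV.Beta.D1BFx.SliceTransferModel (hasDerivAt_matMul hasDerivAt_transpose_mul hasDerivAt_const_mul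
  hasDerivAt_matAdd hasDerivAt_kkt hasDerivAt_kkt_fromRows)
open Summit.QuantumFields.BalabanUV.Beta.D1BFx.GramWeightDeterminant (det_gram_coframe log_absDet_gramTransfer_coframe)

variable {ν μ ρ : Type*} [Fintype ν] [Fintype μ] [Fintype ρ] [DecidableEq ν] [DecidableEq μ] [DecidableEq ρ]

/-- [folklore] **THE SECOND VARIATION OF THE GRAM-FORM SLICE-TRANSFER IDENTITY** (K-TA4G, curve level, frame-free).  `C²` curves `K`, `Q`,
the WEIGHT `B` and the gauge basis `W` (with their first-jet curves and second jets at `0`), a constant comb slice `τ`; near `0`: the Ward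
relations `K·W = 0`, `Kᵀ·W = 0`, `Q·W = 0` and a CO-FRAME FACTORISATION `B = τ′ᵀ·A·τ′` with `τ′·W` and `A` invertible (no derivative of `τ′`,
`A` is used); at `0`: `det(τW) ≠ 0`, `det kkt K [Q; τ] ≠ 0`.  Then, with `M = kkt K [Q; τ]`, `N = kkt (K + B) Q`, the FP GRAM `Φ = WᵀBW` and the
comb Gram `G = τW` (jets as the product rule delivers them):  `secondVar M + secondVar Φ = secondVar N + 2·secondVar G`. -/
theorem secondVar_gramTransfer
    {K K₁ : ℝ → ν → ν → ℝ} {K₂ : Matrix ν ν ℝ} {Q Q₁ : ℝ → μ → ν → ℝ} {Q₂ : Matrix μ ν ℝ}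
    {B B₁ : ℝ → ν → ν → ℝ} {B₂ : Matrix ν ν ℝ} {W W₁ : ℝ → ν → ρ → ℝ} {W₂ : Matrix ν ρ ℝ}
    {T : ℝ → ρ → ν → ℝ} {A : ℝ → ρ → ρ → ℝ} (τ : Matrix ρ ν ℝ)
    (hK : ∀ᶠ u in 𝓝 (0 : ℝ), HasDerivAt K (K₁ u) u) (hK₁ : HasDerivAt K₁ (Matrix.of.symm K₂) 0)
    (hQ : ∀ᶠ u in 𝓝 (0 : ℝ), HasDerivAt Q (Q₁ u) u) (hQ₁ : HasDerivAt Q₁ (Matrix.of.symm Q₂) 0)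
    (hB : ∀ᶠ u in 𝓝 (0 : ℝ), HasDerivAt B (B₁ u) u) (hB₁ : HasDerivAt B₁ (Matrix.of.symm B₂) 0)
    (hW : ∀ᶠ u in 𝓝 (0 : ℝ), HasDerivAt W (W₁ u) u) (hW₁ : HasDerivAt W₁ (Matrix.of.symm W₂) 0)
    (hKW : ∀ᶠ u in 𝓝 (0 : ℝ), Matrix.of (K u) * Matrix.of (W u) = 0)
    (hKtW : ∀ᶠ u in 𝓝 (0 : ℝ), (Matrix.of (K u))ᵀ * Matrix.of (W u) = 0)
    (hQW : ∀ᶠ u in 𝓝 (0 : ℝ), Matrix.of (Q u) * Matrix.of (W u) = 0)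
    (hBfac : ∀ᶠ u in 𝓝 (0 : ℝ), Matrix.of (B u) = (Matrix.of (T u))ᵀ * Matrix.of (A u) * Matrix.of (T u))
    (hTW : ∀ᶠ u in 𝓝 (0 : ℝ), (Matrix.of (T u) * Matrix.of (W u)).det ≠ 0) (hA : ∀ᶠ u in 𝓝 (0 : ℝ), (Matrix.of (A u)).det ≠ 0)
    (hτW : (τ * Matrix.of (W 0)).det ≠ 0) (hM : (kkt (Matrix.of (K 0)) (fromRows (Matrix.of (Q 0)) τ)).det ≠ 0) :
    secondVar (kkt (Matrix.of (K 0)) (fromRows (Matrix.of (Q 0)) τ))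
        (kkt (Matrix.of (K₁ 0)) (fromRows (Matrix.of (Q₁ 0)) (0 : Matrix ρ ν ℝ))) (kkt K₂ (fromRows Q₂ (0 : Matrix ρ ν ℝ)))
      + secondVar ((Matrix.of (W 0))ᵀ * Matrix.of (B 0) * Matrix.of (W 0))
        (((Matrix.of (W₁ 0))ᵀ * Matrix.of (B 0) + (Matrix.of (W 0))ᵀ * Matrix.of (B₁ 0)) * Matrix.of (W 0)
          + (Matrix.of (W 0))ᵀ * Matrix.of (B 0) * Matrix.of (W₁ 0))
        ((W₂ᵀ * Matrix.of (B 0) + (Matrix.of (W₁ 0))ᵀ * Matrix.of (B₁ 0) + ((Matrix.of (W₁ 0))ᵀ * Matrix.of (B₁ 0) + (Matrix.of (W 0))ᵀ * B₂))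
            * Matrix.of (W 0) + ((Matrix.of (W₁ 0))ᵀ * Matrix.of (B 0) + (Matrix.of (W 0))ᵀ * Matrix.of (B₁ 0)) * Matrix.of (W₁ 0)
          + (((Matrix.of (W₁ 0))ᵀ * Matrix.of (B 0) + (Matrix.of (W 0))ᵀ * Matrix.of (B₁ 0)) * Matrix.of (W₁ 0)
            + (Matrix.of (W 0))ᵀ * Matrix.of (B 0) * W₂))
    = secondVar (kkt (Matrix.of (K 0) + Matrix.of (B 0)) (Matrix.of (Q 0)))
        (kkt (Matrix.of (K₁ 0) + Matrix.of (B₁ 0)) (Matrix.of (Q₁ 0))) (kkt (K₂ + B₂) Q₂)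
      + 2 * secondVar (τ * Matrix.of (W 0)) (τ * Matrix.of (W₁ 0)) (τ * W₂) := by
  have hK' : ∀ᶠ u in 𝓝 (0 : ℝ), HasDerivAt K (Matrix.of.symm (Matrix.of (K₁ u))) u := hK
  have hQ' : ∀ᶠ u in 𝓝 (0 : ℝ), HasDerivAt Q (Matrix.of.symm (Matrix.of (Q₁ u))) u := hQ
  have hB' : ∀ᶠ u in 𝓝 (0 : ℝ), HasDerivAt B (Matrix.of.symm (Matrix.of (B₁ u))) u := hB
  have hW' : ∀ᶠ u in 𝓝 (0 : ℝ), HasDerivAt W (Matrix.of.symm (Matrix.of (W₁ u))) u := hW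
  -- (M) the comb-gauged bordered system
  have hMd : ∀ᶠ u in 𝓝 (0 : ℝ), HasDerivAt
      (fun u => Matrix.of.symm (kkt (Matrix.of (K u)) (fromRows (Matrix.of (Q u)) τ)))
      ((fun u => Matrix.of.symm (kkt (Matrix.of (K₁ u)) (fromRows (Matrix.of (Q₁ u)) (0 : Matrix ρ ν ℝ)))) u) u := by
    filter_upwards [hK', hQ'] with u huK huQ
    exact hasDerivAt_kkt_fromRows (T := fun _ => Matrix.of.symm τ) (T' := (0 : Matrix ρ ν ℝ)) huK huQ (hasDerivAt_const u _)
  have hM₁d : HasDerivAt (fun u => Matrix.of.symm (kkt (Matrix.of (K₁ u)) (fromRows (Matrix.of (Q₁ u)) (0 : Matrix ρ ν ℝ))))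
      (Matrix.of.symm (kkt K₂ (fromRows Q₂ (0 : Matrix ρ ν ℝ)))) 0 :=
    hasDerivAt_kkt_fromRows (T := fun _ => Matrix.of.symm (0 : Matrix ρ ν ℝ)) (T' := (0 : Matrix ρ ν ℝ)) hK₁ hQ₁
      (hasDerivAt_const (0 : ℝ) _)
  -- (Φ) the Faddeev–Popov Gram `WᵀBW`
  have hΦd : ∀ᶠ u in 𝓝 (0 : ℝ), HasDerivAt (fun u => Matrix.of.symm ((Matrix.of (W u))ᵀ * Matrix.of (B u) * Matrix.of (W u)))
      ((fun u => Matrix.of.symm (((Matrix.of (W₁ u))ᵀ * Matrix.of (B u) + (Matrix.of (W u))ᵀ * Matrix.of (B₁ u)) * Matrix.of (W u)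
        + (Matrix.of (W u))ᵀ * Matrix.of (B u) * Matrix.of (W₁ u))) u) u := by
    filter_upwards [hB', hW'] with u huB huW
    exact hasDerivAt_matMul (X := fun u => Matrix.of.symm ((Matrix.of (W u))ᵀ * Matrix.of (B u))) (hasDerivAt_transpose_mul huW huB) huW
  have hΦ₁d : HasDerivAt (fun u => Matrix.of.symm (((Matrix.of (W₁ u))ᵀ * Matrix.of (B u) + (Matrix.of (W u))ᵀ * Matrix.of (B₁ u))
        * Matrix.of (W u) + (Matrix.of (W u))ᵀ * Matrix.of (B u) * Matrix.of (W₁ u)))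
      (Matrix.of.symm ((W₂ᵀ * Matrix.of (B 0) + (Matrix.of (W₁ 0))ᵀ * Matrix.of (B₁ 0)
          + ((Matrix.of (W₁ 0))ᵀ * Matrix.of (B₁ 0) + (Matrix.of (W 0))ᵀ * B₂)) * Matrix.of (W 0)
        + ((Matrix.of (W₁ 0))ᵀ * Matrix.of (B 0) + (Matrix.of (W 0))ᵀ * Matrix.of (B₁ 0)) * Matrix.of (W₁ 0)
        + (((Matrix.of (W₁ 0))ᵀ * Matrix.of (B 0) + (Matrix.of (W 0))ᵀ * Matrix.of (B₁ 0)) * Matrix.of (W₁ 0)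
          + (Matrix.of (W 0))ᵀ * Matrix.of (B 0) * W₂))) 0 := by
    have h1 := hasDerivAt_matMul (X := fun u => Matrix.of.symm ((Matrix.of (W₁ u))ᵀ * Matrix.of (B u) + (Matrix.of (W u))ᵀ * Matrix.of (B₁ u)))
      (hasDerivAt_matAdd (hasDerivAt_transpose_mul hW₁ hB'.self_of_nhds) (hasDerivAt_transpose_mul hW'.self_of_nhds hB₁)) hW'.self_of_nhds
    have h2 := hasDerivAt_matMul (X := fun u => Matrix.of.symm ((Matrix.of (W u))ᵀ * Matrix.of (B u)))
      (hasDerivAt_transpose_mul hW'.self_of_nhds hB'.self_of_nhds) hW₁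
    exact h1.add h2
  -- (N) the weighted bordered system
  have hNd : ∀ᶠ u in 𝓝 (0 : ℝ), HasDerivAt (fun u => Matrix.of.symm (kkt (Matrix.of (K u) + Matrix.of (B u)) (Matrix.of (Q u))))
      ((fun u => Matrix.of.symm (kkt (Matrix.of (K₁ u) + Matrix.of (B₁ u)) (Matrix.of (Q₁ u)))) u) u := by
    filter_upwards [hK', hQ', hB'] with u huK huQ huB
    exact hasDerivAt_kkt (H := fun u => Matrix.of.symm (Matrix.of (K u) + Matrix.of (B u))) (hasDerivAt_matAdd huK huB) huQ
  have hN₁d : HasDerivAt (fun u => Matrix.of.symm (kkt (Matrix.of (K₁ u) + Matrix.of (B₁ u)) (Matrix.of (Q₁ u))))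
      (Matrix.of.symm (kkt (K₂ + B₂) Q₂)) 0 :=
    hasDerivAt_kkt (H := fun u => Matrix.of.symm (Matrix.of (K₁ u) + Matrix.of (B₁ u))) (hasDerivAt_matAdd hK₁ hB₁) hQ₁
  -- (G) the comb Gram
  have hGd : ∀ᶠ u in 𝓝 (0 : ℝ), HasDerivAt (fun u => Matrix.of.symm (τ * Matrix.of (W u)))
      ((fun u => Matrix.of.symm (τ * Matrix.of (W₁ u))) u) u := by
    filter_upwards [hW'] with u huW
    exact hasDerivAt_const_mul τ huW
  have hG₁d : HasDerivAt (fun u => Matrix.of.symm (τ * Matrix.of (W₁ u))) (Matrix.of.symm (τ * W₂)) 0 := hasDerivAt_const_mul τ hW₁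
  -- nondegeneracy near 0 and the logarithmic identity (PART 1, co-frame reading)
  have hGne : ∀ᶠ u in 𝓝 (0 : ℝ), (Matrix.of (Matrix.of.symm (τ * Matrix.of (W u)))).det ≠ 0 :=
    eventually_det_ne_zero hGd.self_of_nhds.hasFDerivAt hτW
  have hMne : ∀ᶠ u in 𝓝 (0 : ℝ), (Matrix.of (Matrix.of.symm (kkt (Matrix.of (K u)) (fromRows (Matrix.of (Q u)) τ)))).det ≠ 0 :=
    eventually_det_ne_zero hMd.self_of_nhds.hasFDerivAt hM
  have hlogAll : ∀ᶠ u in 𝓝 (0 : ℝ),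
      (kkt (Matrix.of (K u) + Matrix.of (B u)) (Matrix.of (Q u))).det ≠ 0 ∧
      ((Matrix.of (W u))ᵀ * Matrix.of (B u) * Matrix.of (W u)).det ≠ 0 ∧
      Real.log |(kkt (Matrix.of (K u) + Matrix.of (B u)) (Matrix.of (Q u))).det| + 2 * Real.log |(τ * Matrix.of (W u)).det|
        = Real.log |((Matrix.of (W u))ᵀ * Matrix.of (B u) * Matrix.of (W u)).det|
          + Real.log |(kkt (Matrix.of (K u)) (fromRows (Matrix.of (Q u)) τ)).det| := by
    filter_upwards [hKW, hKtW, hQW, hBfac, hTW, hA, hGne, hMne] with u huKW huKtW huQW huB huTW huA huG huM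
    have huG' : (τ * Matrix.of (W u)).det ≠ 0 := huG
    have huM' : (kkt (Matrix.of (K u)) (fromRows (Matrix.of (Q u)) τ)).det ≠ 0 := huM
    have h := log_absDet_gramTransfer_coframe (Matrix.of (K u)) (Matrix.of (Q u)) τ (Matrix.of (T u)) (Matrix.of (W u)) (Matrix.of (A u))
      huKW huKtW huQW huG' huTW huA huM'
    rw [← huB] at h
    have hΦ : ((Matrix.of (W u))ᵀ * Matrix.of (B u) * Matrix.of (W u)).det ≠ 0 := by
      rw [huB, det_gram_coframe]; exact mul_ne_zero (pow_ne_zero 2 huTW) huA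
    exact ⟨h.1, hΦ, h.2⟩
  have hN : (Matrix.of (Matrix.of.symm (kkt (Matrix.of (K 0) + Matrix.of (B 0)) (Matrix.of (Q 0))))).det ≠ 0 := hlogAll.self_of_nhds.1
  have hΦ0 : (Matrix.of (Matrix.of.symm ((Matrix.of (W 0))ᵀ * Matrix.of (B 0) * Matrix.of (W 0)))).det ≠ 0 := hlogAll.self_of_nhds.2.1
  have hlog : ∀ᶠ u in 𝓝 (0 : ℝ),
      1 * Real.log |(Matrix.of (Matrix.of.symm (kkt (Matrix.of (K u)) (fromRows (Matrix.of (Q u)) τ)))).det|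
      + 1 * Real.log |(Matrix.of (Matrix.of.symm ((Matrix.of (W u))ᵀ * Matrix.of (B u) * Matrix.of (W u)))).det|
      + (-1) * Real.log |(Matrix.of (Matrix.of.symm (kkt (Matrix.of (K u) + Matrix.of (B u)) (Matrix.of (Q u))))).det|
      + (-2) * Real.log |(Matrix.of (Matrix.of.symm (τ * Matrix.of (W u)))).det| = 0 := by
    filter_upwards [hlogAll] with u hu
    have h3 := hu.2.2
    show 1 * Real.log |(kkt (Matrix.of (K u)) (fromRows (Matrix.of (Q u)) τ)).det|
      + 1 * Real.log |((Matrix.of (W u))ᵀ * Matrix.of (B u) * Matrix.of (W u)).det|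
      + (-1) * Real.log |(kkt (Matrix.of (K u) + Matrix.of (B u)) (Matrix.of (Q u))).det|
      + (-2) * Real.log |(τ * Matrix.of (W u)).det| = 0
    linarith
  -- differentiate twice
  have h := secondVar_comb_eq_zero (a := 1) (b := 1) (c := -1) (d := -2) (k := 0)
    hMd hM₁d hM hΦd hΦ₁d hΦ0 hNd hN₁d hN hGd hG₁d hτW hlog
  have h' : 1 * secondVar (kkt (Matrix.of (K 0)) (fromRows (Matrix.of (Q 0)) τ))
        (kkt (Matrix.of (K₁ 0)) (fromRows (Matrix.of (Q₁ 0)) (0 : Matrix ρ ν ℝ))) (kkt K₂ (fromRows Q₂ (0 : Matrix ρ ν ℝ)))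
      + 1 * secondVar ((Matrix.of (W 0))ᵀ * Matrix.of (B 0) * Matrix.of (W 0))
        (((Matrix.of (W₁ 0))ᵀ * Matrix.of (B 0) + (Matrix.of (W 0))ᵀ * Matrix.of (B₁ 0)) * Matrix.of (W 0)
          + (Matrix.of (W 0))ᵀ * Matrix.of (B 0) * Matrix.of (W₁ 0))
        ((W₂ᵀ * Matrix.of (B 0) + (Matrix.of (W₁ 0))ᵀ * Matrix.of (B₁ 0) + ((Matrix.of (W₁ 0))ᵀ * Matrix.of (B₁ 0) + (Matrix.of (W 0))ᵀ * B₂))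
            * Matrix.of (W 0) + ((Matrix.of (W₁ 0))ᵀ * Matrix.of (B 0) + (Matrix.of (W 0))ᵀ * Matrix.of (B₁ 0)) * Matrix.of (W₁ 0)
          + (((Matrix.of (W₁ 0))ᵀ * Matrix.of (B 0) + (Matrix.of (W 0))ᵀ * Matrix.of (B₁ 0)) * Matrix.of (W₁ 0)
            + (Matrix.of (W 0))ᵀ * Matrix.of (B 0) * W₂))
      + (-1) * secondVar (kkt (Matrix.of (K 0) + Matrix.of (B 0)) (Matrix.of (Q 0)))
        (kkt (Matrix.of (K₁ 0) + Matrix.of (B₁ 0)) (Matrix.of (Q₁ 0))) (kkt (K₂ + B₂) Q₂)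
      + (-2) * secondVar (τ * Matrix.of (W 0)) (τ * Matrix.of (W₁ 0)) (τ * W₂) = 0 := h
  linarith


omit [DecidableEq ν] in
/-- [folklore] **THE GRAM SPLIT** (K-TA4G, curve level): with the co-frame factorisation `B = τ′ᵀ·A·τ′` near `0` (now `τ′`, `A` of class `C²`),
`det(τ′₀W₀) ≠ 0`, `det A₀ ≠ 0`: `secondVar Φ = 2·secondVar (τ′W) + secondVar A` for `Φ = WᵀBW` (its jets as in `secondVar_gramTransfer`),
the co-frame Gram `τ′W` (product-rule jets) and `A` — from `det Φ = det(τ′W)²·det A` (`det_gram_coframe`) differentiated twice. -/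
theorem secondVar_gram_split
    {B B₁ : ℝ → ν → ν → ℝ} {B₂ : Matrix ν ν ℝ} {W W₁ : ℝ → ν → ρ → ℝ} {W₂ : Matrix ν ρ ℝ}
    {T T₁ : ℝ → ρ → ν → ℝ} {T₂ : Matrix ρ ν ℝ} {A A₁ : ℝ → ρ → ρ → ℝ} {A₂ : Matrix ρ ρ ℝ}
    (hB : ∀ᶠ u in 𝓝 (0 : ℝ), HasDerivAt B (B₁ u) u) (hB₁ : HasDerivAt B₁ (Matrix.of.symm B₂) 0)
    (hW : ∀ᶠ u in 𝓝 (0 : ℝ), HasDerivAt W (W₁ u) u) (hW₁ : HasDerivAt W₁ (Matrix.of.symm W₂) 0)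
    (hT : ∀ᶠ u in 𝓝 (0 : ℝ), HasDerivAt T (T₁ u) u) (hT₁ : HasDerivAt T₁ (Matrix.of.symm T₂) 0)
    (hA : ∀ᶠ u in 𝓝 (0 : ℝ), HasDerivAt A (A₁ u) u) (hA₁ : HasDerivAt A₁ (Matrix.of.symm A₂) 0)
    (hBfac : ∀ᶠ u in 𝓝 (0 : ℝ), Matrix.of (B u) = (Matrix.of (T u))ᵀ * Matrix.of (A u) * Matrix.of (T u))
    (hTW : (Matrix.of (T 0) * Matrix.of (W 0)).det ≠ 0) (hA0 : (Matrix.of (A 0)).det ≠ 0) :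
    secondVar ((Matrix.of (W 0))ᵀ * Matrix.of (B 0) * Matrix.of (W 0))
        (((Matrix.of (W₁ 0))ᵀ * Matrix.of (B 0) + (Matrix.of (W 0))ᵀ * Matrix.of (B₁ 0)) * Matrix.of (W 0)
          + (Matrix.of (W 0))ᵀ * Matrix.of (B 0) * Matrix.of (W₁ 0))
        ((W₂ᵀ * Matrix.of (B 0) + (Matrix.of (W₁ 0))ᵀ * Matrix.of (B₁ 0) + ((Matrix.of (W₁ 0))ᵀ * Matrix.of (B₁ 0) + (Matrix.of (W 0))ᵀ * B₂))
            * Matrix.of (W 0) + ((Matrix.of (W₁ 0))ᵀ * Matrix.of (B 0) + (Matrix.of (W 0))ᵀ * Matrix.of (B₁ 0)) * Matrix.of (W₁ 0)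
          + (((Matrix.of (W₁ 0))ᵀ * Matrix.of (B 0) + (Matrix.of (W 0))ᵀ * Matrix.of (B₁ 0)) * Matrix.of (W₁ 0)
            + (Matrix.of (W 0))ᵀ * Matrix.of (B 0) * W₂))
      = 2 * secondVar (Matrix.of (T 0) * Matrix.of (W 0)) (Matrix.of (T₁ 0) * Matrix.of (W 0) + Matrix.of (T 0) * Matrix.of (W₁ 0))
          (T₂ * Matrix.of (W 0) + Matrix.of (T₁ 0) * Matrix.of (W₁ 0) + (Matrix.of (T₁ 0) * Matrix.of (W₁ 0) + Matrix.of (T 0) * W₂))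
        + secondVar (Matrix.of (A 0)) (Matrix.of (A₁ 0)) A₂ := by
  have hB' : ∀ᶠ u in 𝓝 (0 : ℝ), HasDerivAt B (Matrix.of.symm (Matrix.of (B₁ u))) u := hB
  have hW' : ∀ᶠ u in 𝓝 (0 : ℝ), HasDerivAt W (Matrix.of.symm (Matrix.of (W₁ u))) u := hW
  have hT' : ∀ᶠ u in 𝓝 (0 : ℝ), HasDerivAt T (Matrix.of.symm (Matrix.of (T₁ u))) u := hT
  have hA' : ∀ᶠ u in 𝓝 (0 : ℝ), HasDerivAt A (Matrix.of.symm (Matrix.of (A₁ u))) u := hA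
  -- (Φ) as in `secondVar_gramTransfer`
  have hΦd : ∀ᶠ u in 𝓝 (0 : ℝ), HasDerivAt (fun u => Matrix.of.symm ((Matrix.of (W u))ᵀ * Matrix.of (B u) * Matrix.of (W u)))
      ((fun u => Matrix.of.symm (((Matrix.of (W₁ u))ᵀ * Matrix.of (B u) + (Matrix.of (W u))ᵀ * Matrix.of (B₁ u)) * Matrix.of (W u)
        + (Matrix.of (W u))ᵀ * Matrix.of (B u) * Matrix.of (W₁ u))) u) u := by
    filter_upwards [hB', hW'] with u huB huW
    exact hasDerivAt_matMul (X := fun u => Matrix.of.symm ((Matrix.of (W u))ᵀ * Matrix.of (B u))) (hasDerivAt_transpose_mul huW huB) huW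
  have hΦ₁d : HasDerivAt (fun u => Matrix.of.symm (((Matrix.of (W₁ u))ᵀ * Matrix.of (B u) + (Matrix.of (W u))ᵀ * Matrix.of (B₁ u))
        * Matrix.of (W u) + (Matrix.of (W u))ᵀ * Matrix.of (B u) * Matrix.of (W₁ u)))
      (Matrix.of.symm ((W₂ᵀ * Matrix.of (B 0) + (Matrix.of (W₁ 0))ᵀ * Matrix.of (B₁ 0)
          + ((Matrix.of (W₁ 0))ᵀ * Matrix.of (B₁ 0) + (Matrix.of (W 0))ᵀ * B₂)) * Matrix.of (W 0)
        + ((Matrix.of (W₁ 0))ᵀ * Matrix.of (B 0) + (Matrix.of (W 0))ᵀ * Matrix.of (B₁ 0)) * Matrix.of (W₁ 0)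
        + (((Matrix.of (W₁ 0))ᵀ * Matrix.of (B 0) + (Matrix.of (W 0))ᵀ * Matrix.of (B₁ 0)) * Matrix.of (W₁ 0)
          + (Matrix.of (W 0))ᵀ * Matrix.of (B 0) * W₂))) 0 := by
    have h1 := hasDerivAt_matMul (X := fun u => Matrix.of.symm ((Matrix.of (W₁ u))ᵀ * Matrix.of (B u) + (Matrix.of (W u))ᵀ * Matrix.of (B₁ u)))
      (hasDerivAt_matAdd (hasDerivAt_transpose_mul hW₁ hB'.self_of_nhds) (hasDerivAt_transpose_mul hW'.self_of_nhds hB₁)) hW'.self_of_nhds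
    have h2 := hasDerivAt_matMul (X := fun u => Matrix.of.symm ((Matrix.of (W u))ᵀ * Matrix.of (B u)))
      (hasDerivAt_transpose_mul hW'.self_of_nhds hB'.self_of_nhds) hW₁
    exact h1.add h2
  -- (τ′W) the co-frame Gram
  have hFd : ∀ᶠ u in 𝓝 (0 : ℝ), HasDerivAt (fun u => Matrix.of.symm (Matrix.of (T u) * Matrix.of (W u)))
      ((fun u => Matrix.of.symm (Matrix.of (T₁ u) * Matrix.of (W u) + Matrix.of (T u) * Matrix.of (W₁ u))) u) u := by
    filter_upwards [hT', hW'] with u huT huW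
    exact hasDerivAt_matMul huT huW
  have hF₁d : HasDerivAt (fun u => Matrix.of.symm (Matrix.of (T₁ u) * Matrix.of (W u) + Matrix.of (T u) * Matrix.of (W₁ u)))
      (Matrix.of.symm (T₂ * Matrix.of (W 0) + Matrix.of (T₁ 0) * Matrix.of (W₁ 0)
        + (Matrix.of (T₁ 0) * Matrix.of (W₁ 0) + Matrix.of (T 0) * W₂))) 0 :=
    (hasDerivAt_matMul hT₁ hW'.self_of_nhds).add (hasDerivAt_matMul hT'.self_of_nhds hW₁)
  -- nondegeneracy near 0 and the logarithmic identity `log|det Φ| = 2·log|det τ′W| + log|det A|`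
  have hFne : ∀ᶠ u in 𝓝 (0 : ℝ), (Matrix.of (Matrix.of.symm (Matrix.of (T u) * Matrix.of (W u)))).det ≠ 0 :=
    eventually_det_ne_zero hFd.self_of_nhds.hasFDerivAt hTW
  have hAne : ∀ᶠ u in 𝓝 (0 : ℝ), (Matrix.of (A u)).det ≠ 0 := eventually_det_ne_zero hA.self_of_nhds.hasFDerivAt hA0
  have hΦ0 : (Matrix.of (Matrix.of.symm ((Matrix.of (W 0))ᵀ * Matrix.of (B 0) * Matrix.of (W 0)))).det ≠ 0 := by
    show ((Matrix.of (W 0))ᵀ * Matrix.of (B 0) * Matrix.of (W 0)).det ≠ 0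
    rw [hBfac.self_of_nhds, det_gram_coframe]; exact mul_ne_zero (pow_ne_zero 2 hTW) hA0
  have hlog : ∀ᶠ u in 𝓝 (0 : ℝ),
      1 * Real.log |(Matrix.of (Matrix.of.symm ((Matrix.of (W u))ᵀ * Matrix.of (B u) * Matrix.of (W u)))).det|
      + (-2) * Real.log |(Matrix.of (Matrix.of.symm (Matrix.of (T u) * Matrix.of (W u)))).det|
      + (-1) * Real.log |(Matrix.of (A u)).det| + 0 * Real.log |(Matrix.of (A u)).det| = 0 := by
    filter_upwards [hBfac, hFne, hAne] with u huB huF huA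
    have huF' : (Matrix.of (T u) * Matrix.of (W u)).det ≠ 0 := huF
    have hdet : ((Matrix.of (W u))ᵀ * Matrix.of (B u) * Matrix.of (W u)).det = (Matrix.of (T u) * Matrix.of (W u)).det ^ 2 * (Matrix.of (A u)).det := by
      rw [huB, det_gram_coframe]
    have hl := congrArg (fun r : ℝ => Real.log |r|) hdet
    simp only [abs_mul, abs_pow] at hl
    rw [Real.log_mul (pow_ne_zero 2 (abs_ne_zero.mpr huF')) (abs_ne_zero.mpr huA), Real.log_pow] at hl
    show 1 * Real.log |((Matrix.of (W u))ᵀ * Matrix.of (B u) * Matrix.of (W u)).det|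
      + (-2) * Real.log |(Matrix.of (T u) * Matrix.of (W u)).det| + (-1) * Real.log |(Matrix.of (A u)).det| + 0 * Real.log |(Matrix.of (A u)).det| = 0
    push_cast at hl
    linarith
  have h := secondVar_comb_eq_zero (a := 1) (b := -2) (c := -1) (d := 0) (k := 0)
    hΦd hΦ₁d hΦ0 hFd hF₁d hTW hA hA₁ hA0 hA hA₁ hA0 hlog
  have h' : 1 * secondVar ((Matrix.of (W 0))ᵀ * Matrix.of (B 0) * Matrix.of (W 0))
        (((Matrix.of (W₁ 0))ᵀ * Matrix.of (B 0) + (Matrix.of (W 0))ᵀ * Matrix.of (B₁ 0)) * Matrix.of (W 0)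
          + (Matrix.of (W 0))ᵀ * Matrix.of (B 0) * Matrix.of (W₁ 0))
        ((W₂ᵀ * Matrix.of (B 0) + (Matrix.of (W₁ 0))ᵀ * Matrix.of (B₁ 0) + ((Matrix.of (W₁ 0))ᵀ * Matrix.of (B₁ 0) + (Matrix.of (W 0))ᵀ * B₂))
            * Matrix.of (W 0) + ((Matrix.of (W₁ 0))ᵀ * Matrix.of (B 0) + (Matrix.of (W 0))ᵀ * Matrix.of (B₁ 0)) * Matrix.of (W₁ 0)
          + (((Matrix.of (W₁ 0))ᵀ * Matrix.of (B 0) + (Matrix.of (W 0))ᵀ * Matrix.of (B₁ 0)) * Matrix.of (W₁ 0)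
            + (Matrix.of (W 0))ᵀ * Matrix.of (B 0) * W₂))
      + (-2) * secondVar (Matrix.of (T 0) * Matrix.of (W 0)) (Matrix.of (T₁ 0) * Matrix.of (W 0) + Matrix.of (T 0) * Matrix.of (W₁ 0))
          (T₂ * Matrix.of (W 0) + Matrix.of (T₁ 0) * Matrix.of (W₁ 0) + (Matrix.of (T₁ 0) * Matrix.of (W₁ 0) + Matrix.of (T 0) * W₂))
      + (-1) * secondVar (Matrix.of (A 0)) (Matrix.of (A₁ 0)) A₂ + 0 * secondVar (Matrix.of (A 0)) (Matrix.of (A₁ 0)) A₂ = 0 := h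
  linarith

end Summit.QuantumFields.BalabanUV.Beta.D1BFx.GramWeightSecondVariation
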